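import Literature.MathematicalPhysics.QuantumFieldTheory.Balaban1983to89.T4MatchingClosureHosts
import Literature.MathematicalPhysics.QuantumFieldTheory.Balaban1983to89.T4PersistentHistoryCount

/-!
# `Balaban1983to89.T4MatchingClosureRecords` — BY-NAME SEAM (ε): the node-U5 closure's two bad-class domination binders
`hDA`, `hDB` (its only binders over an ABSTRACT per-cutoff slot budget on the NE7b side) DISCHARGED from the two runs'
persistence RECORD MODELS; the closure per string, end to end, at PRODUCER LEVEL on both sides
(cell `pub-balaban`, SURGE NODE PROVER #02 lineage = node-U5 closure / assembler; T4-DAG v16 U5 block; journal self-row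
T4-U5.E-CLOSE*-RECORDS; record `t4/T4-EST-U5.md` §0 (s); imports this lineage's `T4MatchingClosureHosts` v1 (p184973)
and unit t4-ne7b-p1's `T4PersistentHistoryCount` (p184435, append-only v1.1/v1.2) ONLY, and modifies nothing)

HONEST FRAMING (cell `pub-balaban`, T4-DAG PAGE 1).  The cell's T4 target is the existence AND uniqueness of the
continuum limit of Bałaban's unit-scale averaged loop expectations on a finite torus — strictly beyond ultraviolet
stability ([Balaban1988Convergent] Cor. 3 p. 264; [Balaban1989LargeFieldII] Thm 1 p. 355); it is NOT infinite volume,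
NOT a mass gap, NOT the Clay problem.  This module is KERNEL BOOKKEEPING ONLY (two compositions, four lines of
budget arithmetic, one non-vacuity witness; 0 estimates, 0 definitions).  It is the fifth seam of the node-U5 two-run
matching design — after seam (δ) no binder on the closure's REMNANT side was an abstract profile; after this seam no
binder on its NE7b side (the domination of the bad class by switched-off good terms) is an abstract per-cutoff BUDGET
either — written BY NAME on landed leaves:
* THE CONSUMER (`T4MatchingClosureHosts` §1/§1b, this lineage gen 14): `hybridNE7_closure_hosts` /
  `stringHybridNE7_closure_hosts` — the node-U5 closure at producer level on the remnant side, whose NE7b-side input is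
  still the pair of binders `hDA : SlotDom l₀ T A Bad (fun K => V·r₀^(K − jlog_C K))`, `hDB : SlotDom l₀ T B Bad (…)`
  with `0 < r₀ < 1`, `0 ≤ V` and the log cut `1 < C·(−log r₀)` (BINDERS, instantiated for nothing);
* THE PRODUCER (unit t4-ne7b-p1, `T4PersistentHistoryCount` §3): `slotDom_of_records` — for ONE weight family, from a
  persistence RECORD MODEL (birth cells `Cell K a` counted by `V·Λ^a`; events with windows `W`, steps `step e ∈ (j, K]`,
  universes `E K j`, birth kinds `B K j`; birth residuals `ρ ≥ 0` with `Σ_b ρ b ≤ ρ̄`, event residuals `η ≥ 0` with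
  per-step sums `≤ η̄`; the rate condition `Λ·e^{η̄ − κ₁} < 1`; ANY cut `j⋆ ≤ K`; and `hdom` = per `(K, t)` a switch-off
  structure whose slots are labelled injectively by (birth step `< j⋆ K`, birth cell), PER-RECORD PRICES
  `y i b Q ≤ ρ b·e^{−κ₁ W b}·∏_{e ∈ Q}(e^{−κ₁ W e}·η e)` and the single-slot ratio bound with ratio `Σ_b Σ_Q y i b Q`)
  exactly `SlotDom l₀ T A Bad (fun K => ρ̄e^{−κ₁}·V·((Λe^{η̄−κ₁})^{K − j⋆K + 1}/(1 − Λe^{η̄−κ₁})))` — every one of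
  these a named binder there; it had NO consumer in the tree before this leaf.

WHAT THIS LEAF DOES, EXACTLY (no over-claim).  (§0) `twoRate_budget_eq`: the producer's budget sequence IS the
consumer's `V′·r₀^(K − j⋆K)` with `r₀ := Λ_c·e^{η̄ − κ₁}`, `V′ := ρ̄e^{−κ₁}·V·r₀/(1 − r₀)` (`funext`, `pow_succ`,
`ring`); `twoRateV_nonneg`: `0 ≤ V′`; `slotDom_congr`: transport of `SlotDom` along an equality of budgets (the
equality case of the landed `T4MatchingClosure.slotDom_mono`, the justification of (R1)).  (§1)
`hybridNE7_closure_records` = the consumer's hybrid-level theorem with `h0 h1 hV hC hDA hDB` REPLACED by: one set of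
rate constants with signs, the rate condition, the log cut at `r₀ := Λ_c·e^{η̄−κ₁}`, and PER RUN the producer's
record-model binders with `j⋆ := jlog_C` — `h0 : 0 < r₀` (from `0 < Λ_c`), `hV : 0 ≤ V′` and the producer's
`hj : jlog_C K ≤ K` (`T4GoodClassBudget.jlogOf_le`) are theorems, `h1 : r₀ < 1` IS the producer's `hσ`.  (§1b)
`stringHybridNE7_closure_records` = the same per string of a torus scheme, end to end: producer-level binders on both
sides + the two partition-function identifications ⇒ `∃ K₁, StringHybridNE7 S os l₀ vol (K₀ + K₁)`, literally the
per-string hypothesis of the consumer's §2 plug `hasContinuumLimit_of_stringClosures` into node U0 (not restated).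

TYPING DECISIONS (recorded so that a cross-reader can diff binder groups 1:1 against the two parents).
(R1) ONE SET OF RATE CONSTANTS `V Λ_c κ₁ ρ̄ η̄` FOR BOTH RUNS, two record models (types `γA εA` / `γB εB`, cells,
events, residuals, `hdomA` on the weights `A`, `hdomB` on `B`).  The consumer has ONE `V, r₀` for both runs; by the
landed `T4MatchingClosure.slotDom_mono` two models with different constants are models for the componentwise worse
ones whenever the worse rate still satisfies the rate condition, so nothing is lost and no maximum is taken inside the
kernel term.
(R2) `0 < Λ_c` (the producer asks `0 ≤ Λ`): needed for `0 < r₀`, i.e. for the consumer's `−log r₀`; harmless (a cell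
count majorant `V·Λ^a` with `Λ = L^d ≥ 1` in every intended reading — NOT instantiated).
(R3) THE CUT.  The producer's cut `j⋆` is free with `j⋆ K ≤ K`; the consumer's two-rate bookkeeping (I-1′ of
`T4MatchingClosure`) fixes it at the log cut `jlog_C K` with `1 < C·(−log r₀)`; so `j⋆ := jlogOf C` here, and the
slots of `hdomA/B` are the births `< jlogOf C K` (the OLD births; young births are the remnant side, seams (β)–(δ)).
(R4) RENAMINGS forced by the composed binder list: the producer's `Λ` is `Λc` (the consumer's `Λ` is the (1.26)_rel
volume constant with `1 ≤ Λ`), its rate condition `hr` is `hσ` (the consumer's `hr : Summable r′`), its birth-kind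
family `B` is `BkA` / `BkB` (the consumer's `B` is run B's weight family), its bound slot variable `birth` is `bth` (the
consumer's `birth` is the polymer birth map of seam (γ)), the step index of `hηbar` is `n` (here `t` is the source).
(R5) Binder ORDER: the consumer's binders in the consumer's order with `h0 h1 hV hC hDA hDB` deleted; in their slot:
the four model types with `DecidableEq`, `V Λc κ₁ ρbar ηbar`, `hV hΛc hκ hσ hC`, then `hA hB` (consumer), then run A's
record block `CellA hcellA WA stepA EA BkA hEA ρA hρA hρbarA ηA hηA hηbarA hdomA` in the producer's order, then run B's;
then `hybridNE7_closure_hosts` verbatim from `hL0` to `hs₂` (in §1b to `hZB`).  The conclusion is the consumer's with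
`V ↦ V′`, `r₀ ↦ Λ_c·e^{η̄−κ₁}` written out (no new definition).

NOT DONE HERE (the producers' obligations; NOT PRINTED as such; proved nowhere in the tree) — the remnant-side list of
`T4MatchingClosureHosts` verbatim (polymer-gas format of the two runs' densities in the Kotecký–Preiss regime, the
two-run activity rate on bank-young discrepant polymers, hosting by geometric genealogy ledgers, old-born size, S-side
credits with one flow per cutoff and uniform majorants, cube counts, remnant domination, the weight / shell halves, the
split budget `hSB`, four summable rates), AND NOW VISIBLY the NE7b-side list, per run: that the run's bad class at
cutoff `K` IS switched off slot by slot onto good terms with the slots labelled injectively by OLD births in counted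
cells (`hdom·` clauses 1–4 — the cell's node NE7b STRUCTURE; print's one-run persistence bookkeeping
[Balaban1989LargeFieldII] pp. 383–387 is the LOCATION of the analogous one-run mechanism, nothing quoted, nothing
two-run is printed), that each slot's weight ratio is a sum of PER-RECORD PRICES of the displayed exponential shape
(`hdom·` clauses 5–7 — the cell's E2-rel / R1 per-record estimate, the load-bearing analytic input, a BINDER), the cell
counts `hcell·`, the event model `hE·`, the residual bars `hρbar· hηbar·`, and the numerical rate condition `hσ` with
the log cut `hC` (whose arithmetic at the cell's witnesses is `T4PersistentHistoryCount` §4–§6/§9–§10, by name, for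
whoever instantiates).  No `SlotDom` / `SwitchOff` / record model is INSTANTIATED for Bałaban's objects (cell ABSOLUTE
RULE; lineage handoff (R3)): every estimate is a binder over abstract types and abstract weights.  SUCCESSOR (not wired
here, by design): the NE7c-side binders `hL0 hLs` (window log-mass) have several producer packagings in the tree
(`T4ShellSuppressionRoute.flattened_inputs_of_twoCurrency`, `T4ShellMeasure`, `T4NestedShells` §4); choosing one is a
separate seam.

ABSOLUTE RULE.  NOTHING of [Balaban 1983–89] is quoted as authority or asserted here; no display is transcribed; no
programme-internal claim is cited; no `[cite:]` tag; page numbers are LOCATIONS.  Every declaration is [folklore]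
bookkeeping over `T4MatchingClosureHosts` §1/§1b and `T4PersistentHistoryCount` §3.

CONTENTS.  §0 `slotDom_congr`, `twoRate_budget_eq`, `twoRateV_nonneg`.  §1 `hybridNE7_closure_records`.
§1b `stringHybridNE7_closure_records`.  §2 `recordBlock_of_bad_empty`: the per-run block `hdom·` (all seven clauses) is
INHABITED in the degenerate regime of an empty bad class by the EMPTY switch-off structure (no slots) — the new binder
group is consistent, not vacuous; the remnant-side block's non-vacuity is inherited (empty catalogue,
`T4MatchingClosureTwoRun` §4 / `T4MatchingClosureBirth` §4), the closure's from `T4MatchingClosure` §8 /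
`T4MatchingClosureYoung` §5, `SlotDom`'s non-trivial inhabitant is `T4HistoryPeeling.slotDom_product` (§5 there).

Value = kernel certificate of THE USER-FACING BINDER LIST OF NODE U5 AT PRODUCER LEVEL ON BOTH SIDES — per string and
for all cutoffs, every hypothesis of the continuum-limit closure is now, by name, a producer obligation of a named cell
node (remnant side: U5a / NE-R1 / NE2⁺-LF / the pv25 hosting identification; NE7b side: the structure clauses and the
E2-rel / R1 per-record price) or a sign / rate / summability condition on a uniform constant; NOT an estimate, NOT
summit progress.  Rung (B)+1 (finite `T⁴`), NOT continuum YM in infinite volume, NOT Clay.  Unit `b2b-balaban-pv02`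
gen 14 (journal CLAIM T4-U5.E-CLOSE*-RECORDS 2026-08-19T08:19:33Z).
-/

open Finset

namespace Literature.MathematicalPhysics.QuantumFieldTheory.Balaban1983to89.T4MatchingClosureRecords

open Literature.MathematicalPhysics.QuantumFieldTheory.Balaban1983to89
open Literature.Probability.LatticeModels
open T4CauchySum T4GoodClassBudget T4HistoryPeeling T4MatchingAssembly T4MatchingClosure T4RemnantBooking
  T4MatchingClosureRem T4MatchingClosureFed T4BankAgeYoung T4MatchingClosureYoung
open B13FamilySum B16Exp198 B16Exp198TwoRun T4NestedLevels T4TwoRunRateAssembly T4MatchingClosureTwoRun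
  T4MatchingClosureBirth T4GeometricLedger T4YoungHosting T4MatchingClosureHosts T4PersistentHistoryCount

/-! ## §0 Two-rate budget arithmetic: the producer's budget is the closure's `V′·r₀^(K − jlog_C K)` -/

section Budget

variable {ι : Type*} [DecidableEq ι] {l₀ : ℝ} {T : ℕ → Finset ι} {A : ℕ → ℝ → ι → ℝ} {Bad : ℕ → ℝ → Finset ι}
  {S S' : ℕ → ℝ}

/-- `SlotDom` transported along an equality of budget sequences (the equality case of the landed
`T4MatchingClosure.slotDom_mono` — `SlotDom` is MONOTONE in its budget, which is also why ONE set of rate constants for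
BOTH runs in §1 loses nothing: two record models with different `V, Λ, κ₁, ρ̄, η̄` are both models for the componentwise
worse constants whenever the worse rate still satisfies `Λσ < 1`). [folklore] -/
theorem slotDom_congr (h : SlotDom l₀ T A Bad S) (e : S = S') : SlotDom l₀ T A Bad S' :=
  slotDom_mono h fun K => (congrFun e K).le

/-- The producer's two-rate budget `C_s·V·(r^{K − j⋆K + 1}/(1 − r))` of `T4PersistentHistoryCount.slotDom_of_records`
(= the budget of `T4MatchingClosure.relWeightBound_of_slotDom_twoRate_log`) IS the closure's `V′·r^{K − j⋆K}` with
`V′ := C_s·V·r/(1 − r)` — as budget SEQUENCES (`funext`; `pow_succ`; `ring`). [folklore] -/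
theorem twoRate_budget_eq (Cs V r : ℝ) (js : ℕ → ℕ) :
    (fun K => Cs * V * (r ^ (K - js K + 1) / (1 - r))) = fun K => Cs * V * r / (1 - r) * r ^ (K - js K) := by
  funext K
  rw [pow_succ]
  ring

/-- Sign of the closure's prefactor `V′ = C_s·V·r/(1 − r)` for `0 ≤ C_s, V`, `0 ≤ r < 1`. [folklore] -/
theorem twoRateV_nonneg {Cs V r : ℝ} (hCs : 0 ≤ Cs) (hV : 0 ≤ V) (hr : 0 ≤ r) (hr1 : r < 1) :
    0 ≤ Cs * V * r / (1 - r) :=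
  div_nonneg (mul_nonneg (mul_nonneg hCs hV) hr) (by linarith)

end Budget

/-! ## §1 The hybrid-level closure with `hDA`, `hDB` discharged from the two runs' persistence record models -/

section HybridRecords

variable {ι : Type*} [DecidableEq ι] {l₀ vol : ℝ} {T : ℕ → Finset ι} {A B Acore Bcore : ℕ → ℝ → ι → ℝ}
  {Bad : ℕ → ℝ → Finset ι} {Cc Rr CcRec RrRec RrRem : ℕ → ℝ → ι → ℝ} {ν u' s₂ c₀ r' s L : ℕ → ℝ}
  {Λ C' ρ θ Cr x c : ℝ} {dd Lb rr : ℕ}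
variable {Dom Cube : ℕ → Type*} [∀ K, DecidableEq (Dom K)] [∀ K, DecidableEq (Cube K)]
  (inc : (K : ℕ) → Dom K → Dom K → Prop) [∀ K, DecidableRel (inc K)] [∀ K, Fintype (Dom K)]
  [∀ K, Std.Refl (inc K)] [∀ K, Std.Symm (inc K)]
  {κ η : Type*} [DecidableEq κ] [DecidableEq η] {ιL Op : Type*} [DecidableEq ιL]

/-- **THE NODE-U5 CLOSURE AT PRODUCER LEVEL ON THE NE7b SIDE TOO** (= `T4MatchingClosureHosts.hybridNE7_closure_hosts`
with its two bad-class domination binders `hDA`, `hDB : SlotDom l₀ T · Bad (fun K => V·r₀^(K − jlog_C K))` DISCHARGED,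
one run each, by ONE application of `T4PersistentHistoryCount.slotDom_of_records` at `j⋆ := jlog_C` to that run's
persistence RECORD MODEL; `r₀ := Λ_c·e^{η̄ − κ₁}`, `V′ := ρ̄e^{−κ₁}·V·r₀/(1 − r₀)` by `twoRate_budget_eq`, so the
closure's `h0`, `hV` are theorems and its `h1` is the producer's rate condition `hσ`).  USER-FACING BINDERS replacing
`h0 h1 hV hC hDA hDB`: ONE set of rate constants `V Λ_c κ₁ ρ̄ η̄` with signs, `hσ : Λ_c·e^{η̄−κ₁} < 1`, the log cut
`hC : 1 < C·(−log(Λ_c·e^{η̄−κ₁}))`; per run the cell counts, event windows / steps / universes / birth kinds with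
`hE`, birth residuals `ρ` and event residuals `η` under the bars, and `hdom` = per `(K, t)` the switch-off structure
with injective birth labelling below the cut, PER-RECORD PRICES and the single-slot ratio bound (typing decisions
(R1)–(R5) of the module docstring).  Everything else is `hybridNE7_closure_hosts` verbatim, in its order.
CONDITIONAL; nothing PRINTED is asserted; nothing instantiated. [folklore] -/
theorem hybridNE7_closure_records
    {C : ℝ} {γA εA γB εB : Type*} [DecidableEq γA] [DecidableEq εA] [DecidableEq γB] [DecidableEq εB]
    {V Λc κ₁ ρbar ηbar : ℝ} (hV : 0 ≤ V) (hΛc : 0 < Λc) (hκ : 0 ≤ κ₁) (hσ : Λc * Real.exp (ηbar - κ₁) < 1)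
    (hC : 1 < C * (-Real.log (Λc * Real.exp (ηbar - κ₁))))
    (hA : ∀ K t, |t| ≤ l₀ → ∀ τ ∈ T K, 0 ≤ A K t τ) (hB : ∀ K t, |t| ≤ l₀ → ∀ τ ∈ T K, 0 ≤ B K t τ)
    -- ─── in the slot of `hDA`: run A's persistence RECORD MODEL (`T4PersistentHistoryCount` §1–§3) ───
    (CellA : ℕ → ℕ → Finset γA) (hcellA : ∀ K a, ((CellA K a).card : ℝ) ≤ V * Λc ^ a)
    (WA stepA : εA → ℕ) (EA BkA : ℕ → ℕ → Finset εA) (hEA : ∀ K j, ∀ e ∈ EA K j, stepA e ∈ Ioc j K)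
    (ρA : εA → ℝ) (hρA : ∀ K j, ∀ b ∈ BkA K j, 0 ≤ ρA b) (hρbarA : ∀ K j, ∑ b ∈ BkA K j, ρA b ≤ ρbar)
    (ηA : εA → ℝ) (hηA : ∀ K j, ∀ e ∈ EA K j, 0 ≤ ηA e)
    (hηbarA : ∀ K j, ∀ n ∈ Ioc j K, ∑ e ∈ EA K j with stepA e = n, ηA e ≤ ηbar)
    (hdomA : ∀ K t, |t| ≤ l₀ → ∃ (n : ℕ) (Φ : SwitchOff (T K) n) (bth : Fin n → ℕ) (cell : Fin n → γA)
        (y : Fin n → εA → Finset εA → ℝ),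
      Bad K t = Φ.bad ∧ (∀ i, bth i < jlogOf C K) ∧ (∀ i, cell i ∈ CellA K (K - bth i)) ∧
      Function.Injective (fun i => (⟨bth i, cell i⟩ : Σ _ : ℕ, γA)) ∧
      (∀ i, ∀ b ∈ BkA K (bth i), ∀ Q ∈ records WA (bth i) K (EA K (bth i)) b, 0 ≤ y i b Q) ∧
      (∀ i, ∀ b ∈ BkA K (bth i), ∀ Q ∈ records WA (bth i) K (EA K (bth i)) b,
        y i b Q ≤ ρA b * Real.exp (-(κ₁ * WA b)) * ∏ e ∈ Q, (Real.exp (-(κ₁ * WA e)) * ηA e)) ∧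
      ∀ i : Fin n, ∀ τ'' ∈ T K, Φ.pend i τ'' = false →
        ∑ τ ∈ T K with (Φ.pend i τ = true ∧ Φ.off i τ = τ''), A K t τ ≤
          (∑ b ∈ BkA K (bth i), ∑ Q ∈ records WA (bth i) K (EA K (bth i)) b, y i b Q) * A K t τ'')
    -- ─── in the slot of `hDB`: run B's persistence RECORD MODEL (`T4PersistentHistoryCount` §1–§3) ───
    (CellB : ℕ → ℕ → Finset γB) (hcellB : ∀ K a, ((CellB K a).card : ℝ) ≤ V * Λc ^ a)
    (WB stepB : εB → ℕ) (EB BkB : ℕ → ℕ → Finset εB) (hEB : ∀ K j, ∀ e ∈ EB K j, stepB e ∈ Ioc j K)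
    (ρB : εB → ℝ) (hρB : ∀ K j, ∀ b ∈ BkB K j, 0 ≤ ρB b) (hρbarB : ∀ K j, ∑ b ∈ BkB K j, ρB b ≤ ρbar)
    (ηB : εB → ℝ) (hηB : ∀ K j, ∀ e ∈ EB K j, 0 ≤ ηB e)
    (hηbarB : ∀ K j, ∀ n ∈ Ioc j K, ∑ e ∈ EB K j with stepB e = n, ηB e ≤ ηbar)
    (hdomB : ∀ K t, |t| ≤ l₀ → ∃ (n : ℕ) (Φ : SwitchOff (T K) n) (bth : Fin n → ℕ) (cell : Fin n → γB)
        (y : Fin n → εB → Finset εB → ℝ),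
      Bad K t = Φ.bad ∧ (∀ i, bth i < jlogOf C K) ∧ (∀ i, cell i ∈ CellB K (K - bth i)) ∧
      Function.Injective (fun i => (⟨bth i, cell i⟩ : Σ _ : ℕ, γB)) ∧
      (∀ i, ∀ b ∈ BkB K (bth i), ∀ Q ∈ records WB (bth i) K (EB K (bth i)) b, 0 ≤ y i b Q) ∧
      (∀ i, ∀ b ∈ BkB K (bth i), ∀ Q ∈ records WB (bth i) K (EB K (bth i)) b,
        y i b Q ≤ ρB b * Real.exp (-(κ₁ * WB b)) * ∏ e ∈ Q, (Real.exp (-(κ₁ * WB e)) * ηB e)) ∧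
      ∀ i : Fin n, ∀ τ'' ∈ T K, Φ.pend i τ'' = false →
        ∑ τ ∈ T K with (Φ.pend i τ = true ∧ Φ.off i τ = τ''), B K t τ ≤
          (∑ b ∈ BkB K (bth i), ∑ Q ∈ records WB (bth i) K (EB K (bth i)) b, y i b Q) * B K t τ'')
    (hL0 : ∀ K, 0 ≤ L K) (hLs : Summable L)
    (hA0 : ∀ K t, |t| ≤ l₀ → ∀ τ ∈ T K, 0 ≤ Acore K t τ)
    (hAlo : ∀ K t, |t| ≤ l₀ → ∀ τ ∈ T K, Acore K t τ ≤ A K t τ)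
    (hAhi : ∀ K t, |t| ≤ l₀ → ∀ τ ∈ T K, A K t τ ≤ Real.exp (L K) * Acore K t τ)
    (hB0 : ∀ K t, |t| ≤ l₀ → ∀ τ ∈ T K, 0 ≤ Bcore K t τ)
    (hBlo : ∀ K t, |t| ≤ l₀ → ∀ τ ∈ T K, Bcore K t τ ≤ B K t τ)
    (hBhi : ∀ K t, |t| ≤ l₀ → ∀ τ ∈ T K, B K t τ ≤ Real.exp (L K) * Bcore K t τ)
    (hΛ : 1 ≤ Λ) (hρ0 : 0 < ρ) (hρ1 : ρ < 1)
    (hq : ((⌈C * Real.log Λ⌉₊ : ℕ) : ℝ) + 3 ≤ C' * (-Real.log ρ)) (hθ : 0 < θ) (hθ1 : θ < 1) (hCr : 0 ≤ Cr)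
    (hx : 0 ≤ x) (hc : 0 ≤ c)
    (hSB : RemnantSplitBudget l₀ vol T Acore Bcore Bad Cc Rr CcRec RrRec RrRem ν u' s₂ c₀ r' s)
    -- ─── in the slot of `hsteps`: the producer's binders (uniform / per cutoff / per term) ───
    {Akp Rkp r₁ skp κ₀ Kkp c₁ bkp τkp νkp : ℝ}
    (hAkp : 0 ≤ Akp) (hKkp : 0 ≤ Kkp) (hτkp : 0 ≤ τkp) (hr₁ : 0 ≤ r₁) (hskp : 0 ≤ skp) (hbkp : 0 ≤ bkp)
    (hrate' : κ₀ + (r₁ + skp) + τkp * c₁ ≤ Rkp) (hsmall : Akp * Real.exp (bkp + τkp * c₁) * Kkp * νkp ≤ τkp)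
    (hdd : 1 ≤ dd) {ce cs p₀ : ℝ} (hce : 0 < ce) (hp : 0 < p₀) (hP5 : ce ≤ cs * p₀)
    (F : ℕ → Flow) {β' : ℝ} (hβ' : 0 ≤ β') (hL : 1 ≤ Lb)
    (hpos : ∀ K j, j ≤ K → 0 < (F K).g j) (hle1 : ∀ K j, j ≤ K → (F K).g j ≤ 1) (hrg : ∀ K, (F K).SatisfiesRG K)
    (hub : ∀ K j, j < K → (F K).β (j + 1) ((F K).g j) ≤ β') (Rw : ℕ → ℕ → ℕ)
    (hRj : ∀ K j, j ≤ K → B14.IsRj Lb rr ((F K).g j) (Rw K j))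
    (hxK : ∀ K, Real.log (((F K).g K) ^ 2)⁻¹ ≤ x) (hcK : ∀ K, ((F K).g K) ^ 2 * β' ≤ c)
    {Nsz : ℕ} (hNsz : 64 ≤ Nsz)
    {Cat Disc : (K : ℕ) → ℝ → ι → ℕ → Finset (Dom K)}
    {cubes out reach : (K : ℕ) → ℝ → ι → ℕ → Dom K → Finset (Cube K)} {dsz : (K : ℕ) → ℝ → ι → ℕ → Dom K → ℝ}
    {wA wB : (K : ℕ) → ℝ → ι → ℕ → Dom K → ℂ}
    (Gl : (K : ℕ) → ℝ → ι → ℕ → Dom K → GeoLedger dd κ η) (birth : (K : ℕ) → ℝ → ι → ℕ → Dom K → ℕ)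
    (Clean : (K : ℕ) → ℝ → ι → ℕ → Dom K → ℕ → ℕ → Prop) {Qy Qo : (K : ℕ) → ℝ → ι → ℕ → Finset (Cube K)}
    (led : ℕ → ℝ → ι → Ledger ιL Op) (rem : ℕ → ℝ → ι → ℕ → Finset ιL)
    (dom : (K : ℕ) → ℝ → ι → ιL → Finset (Cube K))
    (hDisc : ∀ K t, |t| ≤ l₀ → ∀ τ ∈ T K \ Bad K t, ∀ j, Disc K t τ j ⊆ Cat K t τ j)
    (hloc : ∀ K t, |t| ≤ l₀ → ∀ τ ∈ T K \ Bad K t,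
      ∀ j Z, ∀ Z' ∈ Cat K t τ j, inc K Z' Z → ∃ q ∈ reach K t τ j Z, q ∈ out K t τ j Z')
    (hreach : ∀ K t, |t| ≤ l₀ → ∀ τ ∈ T K \ Bad K t,
      ∀ j Z, ((reach K t τ j Z).card : ℝ) ≤ νkp * (out K t τ j Z).card)
    (hdsz : ∀ K t, |t| ≤ l₀ → ∀ τ ∈ T K \ Bad K t, ∀ j Z, 0 ≤ dsz K t τ j Z)
    (hwAΛ : ∀ K t, |t| ≤ l₀ → ∀ τ ∈ T K \ Bad K t, ∀ j Z, Z ∉ Cat K t τ j → wA K t τ j Z = 0)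
    (hwBΛ : ∀ K t, |t| ≤ l₀ → ∀ τ ∈ T K \ Bad K t, ∀ j Z, Z ∉ Cat K t τ j → wB K t τ j Z = 0)
    (hwA : ∀ K t, |t| ≤ l₀ → ∀ τ ∈ T K \ Bad K t,
      ∀ j Z, ‖wA K t τ j Z‖ ≤ Akp * Real.exp (-(Rkp * dsz K t τ j Z)))
    (hwB : ∀ K t, |t| ≤ l₀ → ∀ τ ∈ T K \ Bad K t,
      ∀ j Z, ‖wB K t τ j Z‖ ≤ Akp * Real.exp (-(Rkp * dsz K t τ j Z)))
    (hzero : ∀ K t, |t| ≤ l₀ → ∀ τ ∈ T K \ Bad K t,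
      ∀ j, ∀ Z ∈ Cat K t τ j, Z ∉ Disc K t τ j → wA K t τ j Z = wB K t τ j Z)
    (hbirth : ∀ K t, |t| ≤ l₀ → ∀ τ ∈ T K \ Bad K t, ∀ j ∈ Icc (jlogOf C K) K, ∀ Z ∈ Disc K t τ j,
      BankYoung₂ (Gl K t τ j Z) ce cs p₀ C' K →
        ‖wA K t τ j Z - wB K t τ j Z‖ ≤ Cr * θ ^ birth K t τ j Z * (Akp * Real.exp (-(Rkp * dsz K t τ j Z))))
    (hhost : ∀ K t, |t| ≤ l₀ → ∀ τ ∈ T K \ Bad K t, ∀ j ∈ Icc (jlogOf C K) K, ∀ Z ∈ Disc K t τ j,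
      BankYoung₂ (Gl K t τ j Z) ce cs p₀ C' K →
        Hosts (Gl K t τ j Z) (birth K t τ j Z) j Nsz (Rw K) (Clean K t τ j Z))
    (hsizeA : ∀ K t, |t| ≤ l₀ → ∀ τ ∈ T K \ Bad K t, ∀ j ∈ Icc (jlogOf C K) K, ∀ Z ∈ Disc K t τ j,
      ¬BankYoung₂ (Gl K t τ j Z) ce cs p₀ C' K →
        ‖wA K t τ j Z‖ ≤ ρ ^ ageCut C' K * (Akp * Real.exp (-(Rkp * dsz K t τ j Z))))
    (hsizeB : ∀ K t, |t| ≤ l₀ → ∀ τ ∈ T K \ Bad K t, ∀ j ∈ Icc (jlogOf C K) K, ∀ Z ∈ Disc K t τ j,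
      ¬BankYoung₂ (Gl K t τ j Z) ce cs p₀ C' K →
        ‖wB K t τ j Z‖ ≤ ρ ^ ageCut C' K * (Akp * Real.exp (-(Rkp * dsz K t τ j Z))))
    (h126 : ∀ K t, |t| ≤ l₀ → ∀ τ ∈ T K \ Bad K t, ∀ j, Ineq126 (Cat K t τ j) (out K t τ j) (dsz K t τ j) κ₀ Kkp)
    (hvol : ∀ K t, |t| ≤ l₀ → ∀ τ ∈ T K \ Bad K t, ∀ j, VolBound (Cat K t τ j) (out K t τ j) (dsz K t τ j) c₁)
    (hQy : ∀ K t, |t| ≤ l₀ → ∀ τ ∈ T K \ Bad K t, ∀ j ∈ Icc (jlogOf C K) K, ∀ Z ∈ Disc K t τ j,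
      BankYoung₂ (Gl K t τ j Z) ce cs p₀ C' K → ∃ q ∈ Qy K t τ j, q ∈ out K t τ j Z)
    (hQo : ∀ K t, |t| ≤ l₀ → ∀ τ ∈ T K \ Bad K t, ∀ j ∈ Icc (jlogOf C K) K, ∀ Z ∈ Disc K t τ j,
      ¬BankYoung₂ (Gl K t τ j Z) ce cs p₀ C' K → ∃ q ∈ Qo K t τ j, q ∈ out K t τ j Z)
    (hQyc : ∀ K t, |t| ≤ l₀ → ∀ τ ∈ T K \ Bad K t,
      ∀ j ∈ Icc (jlogOf C K) K, ((Qy K t τ j).card : ℝ) ≤ vol * Λ ^ (K - j))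
    (hQoc : ∀ K t, |t| ≤ l₀ → ∀ τ ∈ T K \ Bad K t,
      ∀ j ∈ Icc (jlogOf C K) K, ((Qo K t τ j).card : ℝ) ≤ vol * Λ ^ (K - j))
    (hnd : ∀ K t, |t| ≤ l₀ → ∀ τ ∈ T K \ Bad K t, (led K t τ).leaves.Nodup)
    (hinj : ∀ K t, |t| ≤ l₀ → ∀ τ ∈ T K \ Bad K t, ∀ j, Set.InjOn (dom K t τ) ↑(rem K t τ j))
    (hRem : ∀ K t, |t| ≤ l₀ → ∀ τ ∈ T K \ Bad K t,
      RrRem K t τ ≤ ∑ j ∈ Icc (jlogOf C K) K, (led K t τ).leafSum fun i => if i ∈ rem K t τ j then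
        ‖locR (inc K) (Cat K t τ j) (cubes K t τ j) (wA K t τ j) (dom K t τ i) -
          locR (inc K) (Cat K t τ j) (cubes K t τ j) (wB K t τ j) (dom K t τ i)‖ else 0)
    -- ─── the consumer's tail ───
    (hr : Summable r') (hu : Summable u') (hs : Summable s) (hs₂ : Summable s₂) :
    ∃ K₀, HybridNE7 l₀ vol (fun K => T (K₀ + K)) (fun K => A (K₀ + K)) (fun K => B (K₀ + K)) (fun K => Bad (K₀ + K))
      (fun K => 1 - Real.exp (-(ρbar * Real.exp (-κ₁) * V * (Λc * Real.exp (ηbar - κ₁)) / (1 - Λc * Real.exp (ηbar - κ₁)) *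
        (Λc * Real.exp (ηbar - κ₁)) ^ (K₀ + K - jlogOf C (K₀ + K)))))
      (fun K t τ => A (K₀ + K) t τ - Acore (K₀ + K) t τ) (fun K t τ => B (K₀ + K) t τ - Bcore (K₀ + K) t τ)
      (fun K => 1 - Real.exp (-L (K₀ + K)))
      (fun K => ((r' (K₀ + K) + ((Akp * Real.exp (bkp + τkp * c₁) * Kkp) * Cr) *
            remnantYoungW θ Λ C (youngWindow dd Lb rr (T4EpochSize.modelC dd) C' x c) (K₀ + K)) +
          (u' (K₀ + K) + remnantOld (fun _ n => 2 * (Akp * Real.exp (bkp + τkp * c₁) * Kkp) * ρ ^ n) Λ C C'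
            (K₀ + K))) + (s (K₀ + K) + s₂ (K₀ + K))) := by
  have hr0 : 0 < Λc * Real.exp (ηbar - κ₁) := mul_pos hΛc (Real.exp_pos _)
  have hρbar : 0 ≤ ρbar := (sum_nonneg (hρA 0 0)).trans (hρbarA 0 0)
  exact hybridNE7_closure_hosts inc hr0 hσ (twoRateV_nonneg (mul_nonneg hρbar (Real.exp_pos _).le) hV hr0.le hσ) hC hA hB
    (slotDom_congr
      (slotDom_of_records CellA hV hΛc.le hcellA WA stepA EA BkA hEA hκ ρA hρA hρbarA ηA hηA hηbarA hσ (jlogOf C)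
        (jlogOf_le C) hdomA)
      (twoRate_budget_eq (ρbar * Real.exp (-κ₁)) V (Λc * Real.exp (ηbar - κ₁)) (jlogOf C)))
    (slotDom_congr
      (slotDom_of_records CellB hV hΛc.le hcellB WB stepB EB BkB hEB hκ ρB hρB hρbarB ηB hηB hηbarB hσ (jlogOf C)
        (jlogOf_le C) hdomB)
      (twoRate_budget_eq (ρbar * Real.exp (-κ₁)) V (Λc * Real.exp (ηbar - κ₁)) (jlogOf C)))
    hL0 hLs hA0 hAlo hAhi hB0 hBlo hBhi hΛ hρ0 hρ1 hq hθ hθ1 hCr hx hc hSB hAkp hKkp hτkp hr₁ hskp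
    hbkp hrate' hsmall hdd hce hp hP5 F hβ' hL hpos hle1 hrg hub Rw hRj hxK hcK hNsz Gl birth Clean led rem dom hDisc
    hloc hreach hdsz hwAΛ hwBΛ hwA hwB hzero hbirth hhost hsizeA hsizeB h126 hvol hQy hQo hQyc hQoc hnd hinj hRem hr hu
    hs hs₂

end HybridRecords

/-! ## §1b The same per string of a torus scheme, end to end -/

section SchemeRecords

open Missing T4Continuum T4Assembly

variable {G : Type*} [GaugeGroup G] [MeasurableSpace G] [HaarData G] {O : Type*}
variable {Dom Cube : ℕ → Type*} [∀ K, DecidableEq (Dom K)] [∀ K, DecidableEq (Cube K)]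
  (inc : (K : ℕ) → Dom K → Dom K → Prop) [∀ K, DecidableRel (inc K)] [∀ K, Fintype (Dom K)]
  [∀ K, Std.Refl (inc K)] [∀ K, Std.Symm (inc K)]
  {κ η : Type*} [DecidableEq κ] [DecidableEq η] {ιL Op : Type*} [DecidableEq ιL]

/-- **PER STRING, END TO END, AT PRODUCER LEVEL ON BOTH THE REMNANT AND THE NE7b SIDE**
(= `T4MatchingClosureHosts.stringHybridNE7_closure_hosts` with `hDA`, `hDB` DISCHARGED exactly as in §1) ⇒
`∃ K₁, StringHybridNE7 S os l₀ vol (K₀ + K₁)`, literally the per-string hypothesis of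
`T4MatchingClosureHosts.hasContinuumLimit_of_stringClosures`. [folklore] -/
theorem stringHybridNE7_closure_records (S : TorusScheme G O) (os : List O) (K₀ : ℕ) {ι : Type}
    [DecidableEq ι] {l₀ vol : ℝ} {T : ℕ → Finset ι} {A B Acore Bcore : ℕ → ℝ → ι → ℝ} {Bad : ℕ → ℝ → Finset ι}
    {Cc Rr CcRec RrRec RrRem : ℕ → ℝ → ι → ℝ} {ν u' s₂ c₀ r' s L : ℕ → ℝ}
    {Λ C' ρ θ Cr x c : ℝ} {dd Lb rr : ℕ}
    {C : ℝ} {γA εA γB εB : Type*} [DecidableEq γA] [DecidableEq εA] [DecidableEq γB] [DecidableEq εB]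
    {V Λc κ₁ ρbar ηbar : ℝ} (hV : 0 ≤ V) (hΛc : 0 < Λc) (hκ : 0 ≤ κ₁) (hσ : Λc * Real.exp (ηbar - κ₁) < 1)
    (hC : 1 < C * (-Real.log (Λc * Real.exp (ηbar - κ₁))))
    (hA : ∀ K t, |t| ≤ l₀ → ∀ τ ∈ T K, 0 ≤ A K t τ) (hB : ∀ K t, |t| ≤ l₀ → ∀ τ ∈ T K, 0 ≤ B K t τ)
    -- ─── in the slot of `hDA`: run A's persistence RECORD MODEL (`T4PersistentHistoryCount` §1–§3) ───
    (CellA : ℕ → ℕ → Finset γA) (hcellA : ∀ K a, ((CellA K a).card : ℝ) ≤ V * Λc ^ a)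
    (WA stepA : εA → ℕ) (EA BkA : ℕ → ℕ → Finset εA) (hEA : ∀ K j, ∀ e ∈ EA K j, stepA e ∈ Ioc j K)
    (ρA : εA → ℝ) (hρA : ∀ K j, ∀ b ∈ BkA K j, 0 ≤ ρA b) (hρbarA : ∀ K j, ∑ b ∈ BkA K j, ρA b ≤ ρbar)
    (ηA : εA → ℝ) (hηA : ∀ K j, ∀ e ∈ EA K j, 0 ≤ ηA e)
    (hηbarA : ∀ K j, ∀ n ∈ Ioc j K, ∑ e ∈ EA K j with stepA e = n, ηA e ≤ ηbar)
    (hdomA : ∀ K t, |t| ≤ l₀ → ∃ (n : ℕ) (Φ : SwitchOff (T K) n) (bth : Fin n → ℕ) (cell : Fin n → γA)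
        (y : Fin n → εA → Finset εA → ℝ),
      Bad K t = Φ.bad ∧ (∀ i, bth i < jlogOf C K) ∧ (∀ i, cell i ∈ CellA K (K - bth i)) ∧
      Function.Injective (fun i => (⟨bth i, cell i⟩ : Σ _ : ℕ, γA)) ∧
      (∀ i, ∀ b ∈ BkA K (bth i), ∀ Q ∈ records WA (bth i) K (EA K (bth i)) b, 0 ≤ y i b Q) ∧
      (∀ i, ∀ b ∈ BkA K (bth i), ∀ Q ∈ records WA (bth i) K (EA K (bth i)) b,
        y i b Q ≤ ρA b * Real.exp (-(κ₁ * WA b)) * ∏ e ∈ Q, (Real.exp (-(κ₁ * WA e)) * ηA e)) ∧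
      ∀ i : Fin n, ∀ τ'' ∈ T K, Φ.pend i τ'' = false →
        ∑ τ ∈ T K with (Φ.pend i τ = true ∧ Φ.off i τ = τ''), A K t τ ≤
          (∑ b ∈ BkA K (bth i), ∑ Q ∈ records WA (bth i) K (EA K (bth i)) b, y i b Q) * A K t τ'')
    -- ─── in the slot of `hDB`: run B's persistence RECORD MODEL (`T4PersistentHistoryCount` §1–§3) ───
    (CellB : ℕ → ℕ → Finset γB) (hcellB : ∀ K a, ((CellB K a).card : ℝ) ≤ V * Λc ^ a)
    (WB stepB : εB → ℕ) (EB BkB : ℕ → ℕ → Finset εB) (hEB : ∀ K j, ∀ e ∈ EB K j, stepB e ∈ Ioc j K)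
    (ρB : εB → ℝ) (hρB : ∀ K j, ∀ b ∈ BkB K j, 0 ≤ ρB b) (hρbarB : ∀ K j, ∑ b ∈ BkB K j, ρB b ≤ ρbar)
    (ηB : εB → ℝ) (hηB : ∀ K j, ∀ e ∈ EB K j, 0 ≤ ηB e)
    (hηbarB : ∀ K j, ∀ n ∈ Ioc j K, ∑ e ∈ EB K j with stepB e = n, ηB e ≤ ηbar)
    (hdomB : ∀ K t, |t| ≤ l₀ → ∃ (n : ℕ) (Φ : SwitchOff (T K) n) (bth : Fin n → ℕ) (cell : Fin n → γB)
        (y : Fin n → εB → Finset εB → ℝ),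
      Bad K t = Φ.bad ∧ (∀ i, bth i < jlogOf C K) ∧ (∀ i, cell i ∈ CellB K (K - bth i)) ∧
      Function.Injective (fun i => (⟨bth i, cell i⟩ : Σ _ : ℕ, γB)) ∧
      (∀ i, ∀ b ∈ BkB K (bth i), ∀ Q ∈ records WB (bth i) K (EB K (bth i)) b, 0 ≤ y i b Q) ∧
      (∀ i, ∀ b ∈ BkB K (bth i), ∀ Q ∈ records WB (bth i) K (EB K (bth i)) b,
        y i b Q ≤ ρB b * Real.exp (-(κ₁ * WB b)) * ∏ e ∈ Q, (Real.exp (-(κ₁ * WB e)) * ηB e)) ∧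
      ∀ i : Fin n, ∀ τ'' ∈ T K, Φ.pend i τ'' = false →
        ∑ τ ∈ T K with (Φ.pend i τ = true ∧ Φ.off i τ = τ''), B K t τ ≤
          (∑ b ∈ BkB K (bth i), ∑ Q ∈ records WB (bth i) K (EB K (bth i)) b, y i b Q) * B K t τ'')
    (hL0 : ∀ K, 0 ≤ L K) (hLs : Summable L)
    (hA0 : ∀ K t, |t| ≤ l₀ → ∀ τ ∈ T K, 0 ≤ Acore K t τ)
    (hAlo : ∀ K t, |t| ≤ l₀ → ∀ τ ∈ T K, Acore K t τ ≤ A K t τ)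
    (hAhi : ∀ K t, |t| ≤ l₀ → ∀ τ ∈ T K, A K t τ ≤ Real.exp (L K) * Acore K t τ)
    (hB0 : ∀ K t, |t| ≤ l₀ → ∀ τ ∈ T K, 0 ≤ Bcore K t τ)
    (hBlo : ∀ K t, |t| ≤ l₀ → ∀ τ ∈ T K, Bcore K t τ ≤ B K t τ)
    (hBhi : ∀ K t, |t| ≤ l₀ → ∀ τ ∈ T K, B K t τ ≤ Real.exp (L K) * Bcore K t τ)
    (hΛ : 1 ≤ Λ) (hρ0 : 0 < ρ) (hρ1 : ρ < 1)
    (hq : ((⌈C * Real.log Λ⌉₊ : ℕ) : ℝ) + 3 ≤ C' * (-Real.log ρ)) (hθ : 0 < θ) (hθ1 : θ < 1) (hCr : 0 ≤ Cr)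
    (hx : 0 ≤ x) (hc : 0 ≤ c)
    (hSB : RemnantSplitBudget l₀ vol T Acore Bcore Bad Cc Rr CcRec RrRec RrRem ν u' s₂ c₀ r' s)
    -- ─── in the slot of `hsteps`: the producer's binders (uniform / per cutoff / per term) ───
    {Akp Rkp r₁ skp κ₀ Kkp c₁ bkp τkp νkp : ℝ}
    (hAkp : 0 ≤ Akp) (hKkp : 0 ≤ Kkp) (hτkp : 0 ≤ τkp) (hr₁ : 0 ≤ r₁) (hskp : 0 ≤ skp) (hbkp : 0 ≤ bkp)
    (hrate' : κ₀ + (r₁ + skp) + τkp * c₁ ≤ Rkp) (hsmall : Akp * Real.exp (bkp + τkp * c₁) * Kkp * νkp ≤ τkp)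
    (hdd : 1 ≤ dd) {ce cs p₀ : ℝ} (hce : 0 < ce) (hp : 0 < p₀) (hP5 : ce ≤ cs * p₀)
    (F : ℕ → Flow) {β' : ℝ} (hβ' : 0 ≤ β') (hL : 1 ≤ Lb)
    (hpos : ∀ K j, j ≤ K → 0 < (F K).g j) (hle1 : ∀ K j, j ≤ K → (F K).g j ≤ 1) (hrg : ∀ K, (F K).SatisfiesRG K)
    (hub : ∀ K j, j < K → (F K).β (j + 1) ((F K).g j) ≤ β') (Rw : ℕ → ℕ → ℕ)
    (hRj : ∀ K j, j ≤ K → B14.IsRj Lb rr ((F K).g j) (Rw K j))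
    (hxK : ∀ K, Real.log (((F K).g K) ^ 2)⁻¹ ≤ x) (hcK : ∀ K, ((F K).g K) ^ 2 * β' ≤ c)
    {Nsz : ℕ} (hNsz : 64 ≤ Nsz)
    {Cat Disc : (K : ℕ) → ℝ → ι → ℕ → Finset (Dom K)}
    {cubes out reach : (K : ℕ) → ℝ → ι → ℕ → Dom K → Finset (Cube K)} {dsz : (K : ℕ) → ℝ → ι → ℕ → Dom K → ℝ}
    {wA wB : (K : ℕ) → ℝ → ι → ℕ → Dom K → ℂ}
    (Gl : (K : ℕ) → ℝ → ι → ℕ → Dom K → GeoLedger dd κ η) (birth : (K : ℕ) → ℝ → ι → ℕ → Dom K → ℕ)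
    (Clean : (K : ℕ) → ℝ → ι → ℕ → Dom K → ℕ → ℕ → Prop) {Qy Qo : (K : ℕ) → ℝ → ι → ℕ → Finset (Cube K)}
    (led : ℕ → ℝ → ι → Ledger ιL Op) (rem : ℕ → ℝ → ι → ℕ → Finset ιL)
    (dom : (K : ℕ) → ℝ → ι → ιL → Finset (Cube K))
    (hDisc : ∀ K t, |t| ≤ l₀ → ∀ τ ∈ T K \ Bad K t, ∀ j, Disc K t τ j ⊆ Cat K t τ j)
    (hloc : ∀ K t, |t| ≤ l₀ → ∀ τ ∈ T K \ Bad K t,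
      ∀ j Z, ∀ Z' ∈ Cat K t τ j, inc K Z' Z → ∃ q ∈ reach K t τ j Z, q ∈ out K t τ j Z')
    (hreach : ∀ K t, |t| ≤ l₀ → ∀ τ ∈ T K \ Bad K t,
      ∀ j Z, ((reach K t τ j Z).card : ℝ) ≤ νkp * (out K t τ j Z).card)
    (hdsz : ∀ K t, |t| ≤ l₀ → ∀ τ ∈ T K \ Bad K t, ∀ j Z, 0 ≤ dsz K t τ j Z)
    (hwAΛ : ∀ K t, |t| ≤ l₀ → ∀ τ ∈ T K \ Bad K t, ∀ j Z, Z ∉ Cat K t τ j → wA K t τ j Z = 0)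
    (hwBΛ : ∀ K t, |t| ≤ l₀ → ∀ τ ∈ T K \ Bad K t, ∀ j Z, Z ∉ Cat K t τ j → wB K t τ j Z = 0)
    (hwA : ∀ K t, |t| ≤ l₀ → ∀ τ ∈ T K \ Bad K t,
      ∀ j Z, ‖wA K t τ j Z‖ ≤ Akp * Real.exp (-(Rkp * dsz K t τ j Z)))
    (hwB : ∀ K t, |t| ≤ l₀ → ∀ τ ∈ T K \ Bad K t,
      ∀ j Z, ‖wB K t τ j Z‖ ≤ Akp * Real.exp (-(Rkp * dsz K t τ j Z)))
    (hzero : ∀ K t, |t| ≤ l₀ → ∀ τ ∈ T K \ Bad K t,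
      ∀ j, ∀ Z ∈ Cat K t τ j, Z ∉ Disc K t τ j → wA K t τ j Z = wB K t τ j Z)
    (hbirth : ∀ K t, |t| ≤ l₀ → ∀ τ ∈ T K \ Bad K t, ∀ j ∈ Icc (jlogOf C K) K, ∀ Z ∈ Disc K t τ j,
      BankYoung₂ (Gl K t τ j Z) ce cs p₀ C' K →
        ‖wA K t τ j Z - wB K t τ j Z‖ ≤ Cr * θ ^ birth K t τ j Z * (Akp * Real.exp (-(Rkp * dsz K t τ j Z))))
    (hhost : ∀ K t, |t| ≤ l₀ → ∀ τ ∈ T K \ Bad K t, ∀ j ∈ Icc (jlogOf C K) K, ∀ Z ∈ Disc K t τ j,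
      BankYoung₂ (Gl K t τ j Z) ce cs p₀ C' K →
        Hosts (Gl K t τ j Z) (birth K t τ j Z) j Nsz (Rw K) (Clean K t τ j Z))
    (hsizeA : ∀ K t, |t| ≤ l₀ → ∀ τ ∈ T K \ Bad K t, ∀ j ∈ Icc (jlogOf C K) K, ∀ Z ∈ Disc K t τ j,
      ¬BankYoung₂ (Gl K t τ j Z) ce cs p₀ C' K →
        ‖wA K t τ j Z‖ ≤ ρ ^ ageCut C' K * (Akp * Real.exp (-(Rkp * dsz K t τ j Z))))
    (hsizeB : ∀ K t, |t| ≤ l₀ → ∀ τ ∈ T K \ Bad K t, ∀ j ∈ Icc (jlogOf C K) K, ∀ Z ∈ Disc K t τ j,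
      ¬BankYoung₂ (Gl K t τ j Z) ce cs p₀ C' K →
        ‖wB K t τ j Z‖ ≤ ρ ^ ageCut C' K * (Akp * Real.exp (-(Rkp * dsz K t τ j Z))))
    (h126 : ∀ K t, |t| ≤ l₀ → ∀ τ ∈ T K \ Bad K t, ∀ j, Ineq126 (Cat K t τ j) (out K t τ j) (dsz K t τ j) κ₀ Kkp)
    (hvol : ∀ K t, |t| ≤ l₀ → ∀ τ ∈ T K \ Bad K t, ∀ j, VolBound (Cat K t τ j) (out K t τ j) (dsz K t τ j) c₁)
    (hQy : ∀ K t, |t| ≤ l₀ → ∀ τ ∈ T K \ Bad K t, ∀ j ∈ Icc (jlogOf C K) K, ∀ Z ∈ Disc K t τ j,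
      BankYoung₂ (Gl K t τ j Z) ce cs p₀ C' K → ∃ q ∈ Qy K t τ j, q ∈ out K t τ j Z)
    (hQo : ∀ K t, |t| ≤ l₀ → ∀ τ ∈ T K \ Bad K t, ∀ j ∈ Icc (jlogOf C K) K, ∀ Z ∈ Disc K t τ j,
      ¬BankYoung₂ (Gl K t τ j Z) ce cs p₀ C' K → ∃ q ∈ Qo K t τ j, q ∈ out K t τ j Z)
    (hQyc : ∀ K t, |t| ≤ l₀ → ∀ τ ∈ T K \ Bad K t,
      ∀ j ∈ Icc (jlogOf C K) K, ((Qy K t τ j).card : ℝ) ≤ vol * Λ ^ (K - j))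
    (hQoc : ∀ K t, |t| ≤ l₀ → ∀ τ ∈ T K \ Bad K t,
      ∀ j ∈ Icc (jlogOf C K) K, ((Qo K t τ j).card : ℝ) ≤ vol * Λ ^ (K - j))
    (hnd : ∀ K t, |t| ≤ l₀ → ∀ τ ∈ T K \ Bad K t, (led K t τ).leaves.Nodup)
    (hinj : ∀ K t, |t| ≤ l₀ → ∀ τ ∈ T K \ Bad K t, ∀ j, Set.InjOn (dom K t τ) ↑(rem K t τ j))
    (hRem : ∀ K t, |t| ≤ l₀ → ∀ τ ∈ T K \ Bad K t,
      RrRem K t τ ≤ ∑ j ∈ Icc (jlogOf C K) K, (led K t τ).leafSum fun i => if i ∈ rem K t τ j then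
        ‖locR (inc K) (Cat K t τ j) (cubes K t τ j) (wA K t τ j) (dom K t τ i) -
          locR (inc K) (Cat K t τ j) (cubes K t τ j) (wB K t τ j) (dom K t τ i)‖ else 0)
    -- ─── the consumer's tail ───
    (hr : Summable r') (hu : Summable u') (hs : Summable s) (hs₂ : Summable s₂)
    (hZA : ∀ K t, |t| ≤ l₀ → T4GenFunBounds.schemeZ S os (K₀ + K) t = ∑ τ ∈ T K, A K t τ)
    (hZB : ∀ K t, |t| ≤ l₀ → T4GenFunBounds.schemeZ S os (K₀ + K + 1) t = ∑ τ ∈ T K, B K t τ) :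
    ∃ K₁, StringHybridNE7 S os l₀ vol (K₀ + K₁) := by
  have hr0 : 0 < Λc * Real.exp (ηbar - κ₁) := mul_pos hΛc (Real.exp_pos _)
  have hρbar : 0 ≤ ρbar := (sum_nonneg (hρA 0 0)).trans (hρbarA 0 0)
  exact stringHybridNE7_closure_hosts inc S os K₀ hr0 hσ (twoRateV_nonneg (mul_nonneg hρbar (Real.exp_pos _).le) hV hr0.le hσ) hC hA hB
    (slotDom_congr
      (slotDom_of_records CellA hV hΛc.le hcellA WA stepA EA BkA hEA hκ ρA hρA hρbarA ηA hηA hηbarA hσ (jlogOf C)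
        (jlogOf_le C) hdomA)
      (twoRate_budget_eq (ρbar * Real.exp (-κ₁)) V (Λc * Real.exp (ηbar - κ₁)) (jlogOf C)))
    (slotDom_congr
      (slotDom_of_records CellB hV hΛc.le hcellB WB stepB EB BkB hEB hκ ρB hρB hρbarB ηB hηB hηbarB hσ (jlogOf C)
        (jlogOf_le C) hdomB)
      (twoRate_budget_eq (ρbar * Real.exp (-κ₁)) V (Λc * Real.exp (ηbar - κ₁)) (jlogOf C)))
    hL0 hLs hA0 hAlo hAhi hB0 hBlo hBhi hΛ hρ0 hρ1 hq hθ hθ1 hCr hx hc hSB hAkp hKkp hτkp hr₁ hskp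
    hbkp hrate' hsmall hdd hce hp hP5 F hβ' hL hpos hle1 hrg hub Rw hRj hxK hcK hNsz Gl birth Clean led rem dom hDisc
    hloc hreach hdsz hwAΛ hwBΛ hwA hwB hzero hbirth hhost hsizeA hsizeB h126 hvol hQy hQo hQyc hQoc hnd hinj hRem hr hu
    hs hs₂ hZA hZB

end SchemeRecords

/-! ## §2 Non-vacuity of the record block: the empty bad class is switched off by NO slots -/

section Sanity

/-- **THE PER-RUN RECORD BLOCK IS INHABITED** (degenerate regime, honest scope): if a run's bad class is EMPTY at every
cutoff and source, then `hdom·` of §1 holds for that run with the EMPTY switch-off structure (`n = 0`: no slots, no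
births, no records, no prices) — for ANY log-cut constant, cells, event data and residuals.  So the binder group that
replaces `hDA`/`hDB` is consistent; it says nothing about Bałaban's bad classes (which are not empty and are not
instantiated anywhere in the tree). [folklore] -/
theorem recordBlock_of_bad_empty {ι γ ε : Type*} [DecidableEq ι] [DecidableEq ε] {l₀ : ℝ} {T : ℕ → Finset ι}
    {A : ℕ → ℝ → ι → ℝ} {Bad : ℕ → ℝ → Finset ι} (hBad : ∀ K t, |t| ≤ l₀ → Bad K t = ∅) (C κ₁ : ℝ)
    (Cell : ℕ → ℕ → Finset γ) (W : ε → ℕ) (E Bk : ℕ → ℕ → Finset ε) (ρ η : ε → ℝ) :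
    ∀ K t, |t| ≤ l₀ → ∃ (n : ℕ) (Φ : SwitchOff (T K) n) (bth : Fin n → ℕ) (cell : Fin n → γ)
        (y : Fin n → ε → Finset ε → ℝ),
      Bad K t = Φ.bad ∧ (∀ i, bth i < jlogOf C K) ∧ (∀ i, cell i ∈ Cell K (K - bth i)) ∧
      Function.Injective (fun i => (⟨bth i, cell i⟩ : Σ _ : ℕ, γ)) ∧
      (∀ i, ∀ b ∈ Bk K (bth i), ∀ Q ∈ records W (bth i) K (E K (bth i)) b, 0 ≤ y i b Q) ∧
      (∀ i, ∀ b ∈ Bk K (bth i), ∀ Q ∈ records W (bth i) K (E K (bth i)) b,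
        y i b Q ≤ ρ b * Real.exp (-(κ₁ * W b)) * ∏ e ∈ Q, (Real.exp (-(κ₁ * W e)) * η e)) ∧
      ∀ i : Fin n, ∀ τ'' ∈ T K, Φ.pend i τ'' = false →
        ∑ τ ∈ T K with (Φ.pend i τ = true ∧ Φ.off i τ = τ''), A K t τ ≤
          (∑ b ∈ Bk K (bth i), ∑ Q ∈ records W (bth i) K (E K (bth i)) b, y i b Q) * A K t τ'' := by
  intro K t ht
  have Φ0 : SwitchOff (T K) 0 :=
    ⟨fun i => i.elim0, fun i => i.elim0, fun i => i.elim0, fun i => i.elim0, fun i => i.elim0, fun i => i.elim0⟩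
  refine ⟨0, Φ0, Fin.elim0, Fin.elim0, Fin.elim0, ?_, fun i => i.elim0, fun i => i.elim0, fun i => i.elim0,
    fun i => i.elim0, fun i => i.elim0, fun i => i.elim0⟩
  rw [hBad K t ht]
  exact (Finset.eq_empty_of_forall_notMem fun τ hτ => by
    obtain ⟨i, -⟩ := Φ0.charge_nonempty_of_mem_bad hτ
    exact i.elim0).symm

/-- … and then `slotDom_of_records` returns the two-rate `SlotDom` of an empty bad class from it (the §1 discharge
path, exercised once in the kernel on the degenerate model: `V = Λ = κ₁ = ρ̄ = η̄ = 0`, no cells, no events). [folklore] -/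
example {ι : Type*} [DecidableEq ι] {l₀ : ℝ} {T : ℕ → Finset ι} {A : ℕ → ℝ → ι → ℝ} {Bad : ℕ → ℝ → Finset ι}
    (hBad : ∀ K t, |t| ≤ l₀ → Bad K t = ∅) (C : ℝ) :
    SlotDom l₀ T A Bad fun K => (0 : ℝ) * Real.exp (-0) * 0 *
      (((0 : ℝ) * Real.exp (0 - 0)) ^ (K - jlogOf C K + 1) / (1 - 0 * Real.exp (0 - 0))) :=
  slotDom_of_records (γ := ℕ) (ε := ℕ) (fun _ _ => ∅) le_rfl le_rfl (fun K a => by simp) (fun _ => 0) (fun _ => 0)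
    (fun _ _ => ∅) (fun _ _ => ∅) (fun K j e he => by simp at he) le_rfl (fun _ => 0) (fun K j b hb => by simp at hb)
    (fun K j => by simp) (fun _ => 0) (fun K j e he => by simp at he) (fun K j n hn => by simp)
    (by rw [zero_mul]; exact zero_lt_one) (jlogOf C) (jlogOf_le C)
    (recordBlock_of_bad_empty hBad C 0 (fun _ _ => ∅) (fun _ => 0) (fun _ _ => ∅) (fun _ _ => ∅) (fun _ => 0)
      fun _ => 0)

end Sanity

end Literature.MathematicalPhysics.QuantumFieldTheory.Balaban1983to89.T4MatchingClosureRecords
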